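import Mathlib
import Summits.PneNP.PneNP.Theorems.ClusUniversalCertificateLayerDefs

/-!
# Route ClusUniversalCertificate, crux `UniversalCertAll` — line `layer`: registered stub `stub_layerStep`

Stub file for `stmt-PneNP-19683` (cell pnp-ideate, route `ClusUniversalCertificate`, rung F-N1; line `layer`
of pnp-ideate-p1 g6, skeleton v2 sha16 cfd997240e04): **`stub_layerStep : LayerStepAll`** — the induction
step of the one-block induction via layer families. Pure bookkeeping:

* DOUBLE COUNTING through a layer family `L` of `(Y, k)` (`sum_card_filter_layer`): for every property
  `P` of points one block down, `Σ_{S ∈ L} #{x ∈ S : P x} = #{y ∈ Y : P (π y)}`, `π = Fin.removeNth k`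
  (swap the list sum with the finite sum over points, then the layer multiplicity and
  `Finset.card_eq_sum_card_fiberwise`); with `P = ⊤`: `Σ_{S∈L} |S| = |Y|`; with `P = (· j = 0)`:
  `Σ_{S∈L} Z_j(S) = Z_{k.succAbove j}(Y)`;
* `dimSum_eq`: `D(S) = Σ_{x∈S} (n − codim_S x) + n(m−1)|S|`;
* hence the members' `n`-block certificates, the layer inequality and `Fin.sum_univ_succAbove` give the
  `(n+1)`-block certificate of `Y` (`stub_layerStep`).

FRONTIER rung F-N1 (a combinatorial certificate about affine flats in `(𝔽₂^m)^n`); nothing here bears on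
P vs NP.
-/

set_option linter.dupNamespace false -- `Summit.PneNP.PneNP.…`: summit = sub-problem name (D-0017 single-conjunct layout)

namespace Summit.PneNP.PneNP.Theorems.ClusLayerStep

open Finset
open Summit.PneNP.PneNP.Theorems.ClusSkew (codimY)
open Summit.PneNP.PneNP.Theorems.ClusLayer (dimSum UCIneq IsLayerFamily LayerIneq LayerStepAll)

variable {n m : ℕ}

/-! ## Swapping a list sum with a finite sum -/

/-- A list sum of finite sums is the finite sum of the list sums. -/
theorem list_sum_map_finset_sum {α β : Type} (L : List α) (U : Finset β) (g : α → β → ℤ) :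
    (L.map fun S => ∑ x ∈ U, g S x).sum = ∑ x ∈ U, (L.map fun S => g S x).sum := by
  induction L with
  | nil => simp
  | cons S L ih => simp only [List.map_cons, List.sum_cons, Finset.sum_add_distrib, ih]

/-- Counting the members of a list containing a point, as a list sum of indicators. -/
theorem list_sum_indicator {α : Type} (L : List (Finset α)) (x : α) [DecidableEq α] :
    (L.map fun S => if x ∈ S then (1 : ℤ) else 0).sum = ((L.filter fun S => x ∈ S).length : ℤ) := by
  induction L with
  | nil => simp
  | cons S L ih =>
    rw [List.map_cons, List.sum_cons, ih]
    by_cases h : x ∈ S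
    · simp [h, add_comm]
    · simp [h]

/-! ## Double counting through a layer family -/

/-- **Double counting.** For a layer family `L` of `(Y, k)` and any property `P` of points one block down,
`Σ_{S ∈ L} #{x ∈ S : P x} = #{y ∈ Y : P (π y)}` with `π = Fin.removeNth k`. -/
theorem sum_card_filter_layer (Y : Finset (Fin (n + 1) → Fin m → ZMod 2)) (k : Fin (n + 1))
    (L : List (Finset (Fin n → Fin m → ZMod 2))) (hL : IsLayerFamily m Y k L)
    (P : (Fin n → Fin m → ZMod 2) → Prop) [DecidablePred P] :
    (L.map fun S => ((S.filter P).card : ℤ)).sum = ((Y.filter fun y => P (Fin.removeNth k y)).card : ℤ) := by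
  -- each member's count as a sum of indicators over the points satisfying `P`
  have hS : ∀ S : Finset (Fin n → Fin m → ZMod 2),
      ((S.filter P).card : ℤ) = ∑ x ∈ univ.filter P, (if x ∈ S then (1 : ℤ) else 0) := by
    intro S
    rw [Finset.sum_ite_mem, Finset.card_eq_sum_ones, Nat.cast_sum]
    simp only [Nat.cast_one]
    congr 1
    ext x
    simp [and_comm]
  have hL' : ∀ x : Fin n → Fin m → ZMod 2,
      ((L.filter fun S => x ∈ S).length : ℤ) = ((Y.filter fun y => Fin.removeNth k y = x).card : ℤ) :=
    fun x => by rw [hL x]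
  simp_rw [hS]
  rw [list_sum_map_finset_sum]
  simp_rw [list_sum_indicator, hL']
  -- fibrewise count of `Y.filter (P ∘ π)` along `π`
  rw [Finset.card_eq_sum_card_fiberwise (f := fun y => Fin.removeNth k y) (s := Y.filter fun y => P (Fin.removeNth k y))
    (t := univ.filter P) (fun y hy => Finset.mem_filter.2 ⟨Finset.mem_univ _, (Finset.mem_filter.1 hy).2⟩)]
  push_cast
  refine Finset.sum_congr rfl fun x hx => ?_
  have hPx : P x := (Finset.mem_filter.1 hx).2
  congr 2
  ext y
  simp only [Finset.mem_filter]
  constructor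
  · rintro ⟨hy, hyx⟩; exact ⟨⟨hy, hyx ▸ hPx⟩, hyx⟩
  · rintro ⟨⟨hy, -⟩, hyx⟩; exact ⟨hy, hyx⟩

/-- `Σ_{S ∈ L} |S| = |Y|`. -/
theorem sum_card_layer (Y : Finset (Fin (n + 1) → Fin m → ZMod 2)) (k : Fin (n + 1))
    (L : List (Finset (Fin n → Fin m → ZMod 2))) (hL : IsLayerFamily m Y k L) :
    (L.map fun S => (S.card : ℤ)).sum = (Y.card : ℤ) := by
  have h := sum_card_filter_layer Y k L hL (fun _ => True)
  simp only [Finset.filter_true_of_mem (fun _ _ => trivial)] at h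
  exact h

/-- `Σ_{S ∈ L} Z_j(S) = Z_{k.succAbove j}(Y)`. -/
theorem sum_zero_layer (Y : Finset (Fin (n + 1) → Fin m → ZMod 2)) (k : Fin (n + 1))
    (L : List (Finset (Fin n → Fin m → ZMod 2))) (hL : IsLayerFamily m Y k L) (j : Fin n) :
    (L.map fun S => ((S.filter fun x => x j = 0).card : ℤ)).sum =
      ((Y.filter fun y => y (k.succAbove j) = 0).card : ℤ) :=
  sum_card_filter_layer Y k L hL (fun x => x j = 0)

/-! ## The induction step -/

/-- `D(S)` against the certificate's left-hand side: `D(S) = Σ_{x∈S}(n − codim) + n(m−1)|S|`. -/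
theorem dimSum_eq (S : Finset (Fin n → Fin m → ZMod 2)) :
    dimSum m S = ∑ x ∈ S, ((n : ℤ) - (codimY m S x : ℤ)) + (n : ℤ) * ((m : ℤ) - 1) * (S.card : ℤ) := by
  unfold dimSum
  rw [Finset.card_eq_sum_ones, Nat.cast_sum, Finset.mul_sum, ← Finset.sum_add_distrib]
  refine Finset.sum_congr rfl fun x _ => ?_
  push_cast
  ring

/-- Pointwise comparison of list sums. -/
theorem list_sum_map_le {α : Type} (L : List α) (f g : α → ℤ) (h : ∀ S ∈ L, f S ≤ g S) :
    (L.map f).sum ≤ (L.map g).sum := by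
  induction L with
  | nil => simp
  | cons S L ih =>
    simp only [List.map_cons, List.sum_cons]
    exact add_le_add (h S (by simp)) (ih fun T hT => h T (by simp [hT]))

/-- List sums of sums. -/
theorem list_sum_map_add {α : Type} (L : List α) (f g : α → ℤ) :
    (L.map fun S => f S + g S).sum = (L.map f).sum + (L.map g).sum := by
  induction L with
  | nil => simp
  | cons S L ih => simp only [List.map_cons, List.sum_cons, ih]; ring

/-- List sums of scalar multiples. -/
theorem list_sum_map_mul {α : Type} (L : List α) (c : ℤ) (f : α → ℤ) :
    (L.map fun S => c * f S).sum = c * (L.map f).sum := by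
  induction L with
  | nil => simp
  | cons S L ih => simp only [List.map_cons, List.sum_cons, ih]; ring

end Summit.PneNP.PneNP.Theorems.ClusLayerStep

namespace Summit.PneNP.PneNP.Theorems.ClusLayer

open Finset
open Summit.PneNP.PneNP.Theorems.ClusSkew (codimY)
open Summit.PneNP.PneNP.Theorems.ClusLayerStep

/-- **Registered stub `stub_layerStep` of the line `layer`** (stmt-PneNP-19683): the induction step —
a layer family, the layer inequality and the `n`-block certificates of the members give the
`(n + 1)`-block certificate (pure bookkeeping: `Σ|S| = |Y|`, `Σ Z_j(S) = Z_{k.succAbove j}(Y)`,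
`(n·m − codim) − n(m−1) = n − codim`, `Fin.sum_univ_succAbove`). -/
theorem stub_layerStep : LayerStepAll := by
  intro n m Y k L hfam hineq hmem
  unfold UCIneq
  unfold LayerIneq at hineq
  -- the members' certificates, summed
  have hmem' : ∀ S ∈ L, dimSum m S ≤
      (2 : ℤ) ^ m * (∑ j : Fin n, ((S.filter fun x => x j = 0).card : ℤ)) + (n : ℤ) * ((m : ℤ) - 1) * (S.card : ℤ) := by
    intro S hS
    have h := hmem S hS
    unfold UCIneq at h
    rw [← Finset.mul_sum] at h
    rw [dimSum_eq]
    linarith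
  have hsumD : (L.map (dimSum m)).sum ≤
      (2 : ℤ) ^ m * (∑ j : Fin n, ((Y.filter fun y => y (k.succAbove j) = 0).card : ℤ)) +
        (n : ℤ) * ((m : ℤ) - 1) * (Y.card : ℤ) := by
    refine (list_sum_map_le L _ _ hmem').trans (le_of_eq ?_)
    rw [list_sum_map_add, list_sum_map_mul, list_sum_map_mul, sum_card_layer Y k L hfam]
    congr 2
    rw [list_sum_map_finset_sum]
    exact Finset.sum_congr rfl fun j _ => sum_zero_layer Y k L hfam j
  -- `D(Y)` against the goal's left-hand side
  have hDY : dimSum m Y = ∑ y ∈ Y, (((n + 1 : ℕ) : ℤ) - (codimY m Y y : ℤ)) +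
      ((n : ℤ) + 1) * ((m : ℤ) - 1) * (Y.card : ℤ) := by
    rw [dimSum_eq]; push_cast; ring
  -- the right-hand side splits off block `k`
  rw [Fin.sum_univ_succAbove _ k]
  have hfac : ∑ i : Fin n, (2 : ℤ) ^ m * ((Y.filter fun y => y (k.succAbove i) = 0).card : ℤ) =
      (2 : ℤ) ^ m * ∑ i : Fin n, ((Y.filter fun y => y (k.succAbove i) = 0).card : ℤ) :=
    (Finset.mul_sum _ _ _).symm
  linarith


end Summit.PneNP.PneNP.Theorems.ClusLayer
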